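/-
Copyright (c) 2026. All rights reserved.
Released under Apache 2.0 license as described in the file LICENSE.
Authors: abc-iut cell — seat abc-iut-w4-d089 (wave 4, gen 8; row «T54iii·hcont»), after abc-iut-w4-d071 (integrated
Thm 5.4 line v1–v5, p447359).
-/
import Literature.AnabelianGeometry.SemiGraphs.ArithThm54IntegratedChartAnyRepresentatives
import Literature.AnabelianGeometry.SemiGraphs.ArithBTempOuterModelContinuousChart
import HarnessLib

/-!
# [SemiAnbd] THEOREM 5.4 (i) ∧ (ii) ∧ (iii) at the outer models, INTEGRATED, v6 — the law `hcont`
# (continuity of the canonical `B^temp(φ)`) DISCHARGED (proof-only; thin successor of p447359)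

Mochizuki, *Semi-graphs of anabelioids*, Publ. RIMS **42** (2006), §5 Def 5.1 (i) p. 62, Prop 5.2 (iv) p. 64,
Thm 5.4 p. 66 [cite: MochizukiSemiAnbd2006, Thm 5.4, p. 66].

PROOF-ONLY file (abc-iut cell, layer L3, T54 board; seat abc-iut-w4-d089 gen 8).  No definition, no new named fact,
no producer restated.  v5 (`arithThm54_outerModels_chart_of_producers_anyRepresentatives`, abc-iut-w4-d071) carried,
across the two sides, ONE law of the canonical `B^temp(φ) = outerSemidirectProductMap …` as a binder: its continuity
`hcont` for abc-iut-w6-d070's tempered level topologies.  That law is now a THEOREM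
(`ProfiniteSemiGraph.continuous_outerSemidirectProductMap_arithLevelTopology`, `ArithBTempOuterModelContinuousChart.lean`:
level-kernel neighbourhoods + congruence-continuity `hK1′` of the target + Thm 3.7 (i)(ii) at one vertex + compactness
of one verticial subgroup — no finite-index-is-open input), so v6 has EXACTLY v5's binders minus `hcont`, the same
conclusion, and is proved by one application of v5.

* `arithThm54_outerModels_chart_of_producers_anyRepresentatives_hcontFree` — v5 without `hcont`.
HONEST RESIDUAL per side (unchanged from v5): Cor39Hypotheses · finiteness · tower data hcof hS hfin hne hconn · hker ·
hfaithV · DESIGN hV hE hopen hBR (F θ hrep) · T R Rc w d · n hCC · hinst (rfl) · noSwitchBase · hRcV hRcB (pin) · hest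
hbot; across: dict θd hlo φc hφc hfaith hfull hpre hpost · he — and NOTHING ELSE (`hcont` gone).  Nothing beyond composition
is proved here; typed ≠ proved for the residual inputs; Thm 5.4 for OUR tower decompositions; no side taken on
[IUTchIII] Cor. 3.12.
-/

namespace Literature.AnabelianGeometry.SemiGraphs

open _root_.CategoryTheory _root_.Topology _root_.Filter ProfiniteSemiGraph Literature.AnabelianGeometry.EtaleTheta
open scoped Pointwise

universe u v u₀

variable {Obj : Type u} [Category.{v} Obj] {𝓥 : SemiAnbdVocab.{u, v, u₀} Obj}
variable {𝔊 ℍ : ArithSemiGraph 𝓥} {e : 𝔊.PA ≃* ℍ.PA}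
variable {𝒢 ℋ : ProfiniteSemiGraph.{u₀}}

/-- **[SemiAnbd] THEOREM 5.4 (i) ∧ (ii) ∧ (iii) at the outer models, INTEGRATED, v6 — `hcont` DISCHARGED**: v5
(`arithThm54_outerModels_chart_of_producers_anyRepresentatives`) with the continuity law of the canonical `B^temp(φ)`
supplied by `continuous_outerSemidirectProductMap_arithLevelTopology` instead of assumed.  Residual: module docstring.
[cite: MochizukiSemiAnbd2006, Thm 5.4, p. 66] -/
theorem arithThm54_outerModels_chart_of_producers_anyRepresentatives_hcontFree
    -- ── the 𝔾 side: a cofinal Galois tower with characteristic levels, its chart, the outer model over `Π_A` ──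
    (h39𝒢 : Cor39Hypotheses 𝒢) (D𝒢 : GaloisLevelData 𝒢)
    (hcof𝒢 : ∀ (X : CovObj 𝒢), X.IsTempered → ∀ p : X.Point, ∃ i : ℕ, ∀ j, i ≤ j → (D𝒢.S j).Splits (X.component p))
    (hS𝒢 : ∀ n, (D𝒢.S n).Splits (D𝒢.S n)) (hfin𝒢 : ∀ n, (D𝒢.S n).IsFinite) (hne𝒢 : ∀ n, (D𝒢.S n).HasNonemptyFibres)
    (hconn𝒢 : ∀ (n : ℕ) (p q : (D𝒢.S n).Point), (D𝒢.S n).SameComponent p q)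
    [Finite 𝒢.graph.Vertex] [Finite 𝒢.graph.Branch]
    [Finite 𝒢.graph.Edge]
    (ρ𝒢 : 𝔊.PA →* TopOut (D𝒢.chart h39𝒢.toProp36Hypotheses.isCountable hcof𝒢 h39𝒢.toProp36Hypotheses.isConnected hS𝒢 hfin𝒢 hne𝒢).G) (baseAct𝒢 : 𝔊.PA →* Aut 𝒢.graph)
    [inst𝒢 : TopologicalSpace (outerSemidirectProduct ρ𝒢)]
    (T𝒢 : ∀ w : 𝒢.graph.Vertex, D𝒢.PointSeq h39𝒢.toProp36Hypotheses.isCountable w) (R𝒢 : SemiGraph.RefBranches 𝒢.graph)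
    (Rc𝒢 : ChartRepresentatives (D𝒢.chart h39𝒢.toProp36Hypotheses.isCountable hcof𝒢 h39𝒢.toProp36Hypotheses.isConnected hS𝒢 hfin𝒢 hne𝒢))
    -- Prop 3.6 (iv) at `ρ_𝔾(a)` / Def 5.1 (i)(c): the DESIGN data of the outer model (abc-iut-w4-d082's currency)
    (hV𝒢 : ∀ (a : 𝔊.PA) (v : 𝒢.graph.Vertex) (H : Subgroup (D𝒢.chart h39𝒢.toProp36Hypotheses.isCountable hcof𝒢 h39𝒢.toProp36Hypotheses.isConnected hS𝒢 hfin𝒢 hne𝒢).G), H ∈ verticialSubgroups (D𝒢.chart h39𝒢.toProp36Hypotheses.isCountable hcof𝒢 h39𝒢.toProp36Hypotheses.isConnected hS𝒢 hfin𝒢 hne𝒢) v →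
      ∃ φ : contMulAut (D𝒢.chart h39𝒢.toProp36Hypotheses.isCountable hcof𝒢 h39𝒢.toProp36Hypotheses.isConnected hS𝒢 hfin𝒢 hne𝒢).G, TopOut.mk _ φ = ρ𝒢 a ∧
        H.map (φ : MulAut (D𝒢.chart h39𝒢.toProp36Hypotheses.isCountable hcof𝒢 h39𝒢.toProp36Hypotheses.isConnected hS𝒢 hfin𝒢 hne𝒢).G).toMonoidHom ∈ verticialSubgroups (D𝒢.chart h39𝒢.toProp36Hypotheses.isCountable hcof𝒢 h39𝒢.toProp36Hypotheses.isConnected hS𝒢 hfin𝒢 hne𝒢) ((baseAct𝒢 a).hom.vertexMap v))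
    (hE𝒢 : ∀ (a : 𝔊.PA) (e : 𝒢.graph.Edge) (K : Subgroup (D𝒢.chart h39𝒢.toProp36Hypotheses.isCountable hcof𝒢 h39𝒢.toProp36Hypotheses.isConnected hS𝒢 hfin𝒢 hne𝒢).G), K ∈ edgeLikeSubgroups (D𝒢.chart h39𝒢.toProp36Hypotheses.isCountable hcof𝒢 h39𝒢.toProp36Hypotheses.isConnected hS𝒢 hfin𝒢 hne𝒢) e →
      ∃ φ : contMulAut (D𝒢.chart h39𝒢.toProp36Hypotheses.isCountable hcof𝒢 h39𝒢.toProp36Hypotheses.isConnected hS𝒢 hfin𝒢 hne𝒢).G, TopOut.mk _ φ = ρ𝒢 a ∧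
        K.map (φ : MulAut (D𝒢.chart h39𝒢.toProp36Hypotheses.isCountable hcof𝒢 h39𝒢.toProp36Hypotheses.isConnected hS𝒢 hfin𝒢 hne𝒢).G).toMonoidHom ∈ edgeLikeSubgroups (D𝒢.chart h39𝒢.toProp36Hypotheses.isCountable hcof𝒢 h39𝒢.toProp36Hypotheses.isConnected hS𝒢 hfin𝒢 hne𝒢) ((baseAct𝒢 a).hom.edgeMap e))
    (hopen𝒢 : ∃ U : Subgroup 𝔊.PA, IsOpen (U : Set 𝔊.PA) ∧ ∀ a ∈ U,
      (∀ v, (baseAct𝒢 a).hom.vertexMap v = v) ∧ (∀ e, (baseAct𝒢 a).hom.edgeMap e = e) ∧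
        ∀ b, (baseAct𝒢 a).hom.branchMap b = b)
    (hBR𝒢 : ∀ (a : 𝔊.PA) (b : 𝒢.graph.Branch) (v : 𝒢.graph.Vertex) (hb : 𝒢.graph.abuts b = some v)
      (φ : 𝒢.Gv v →ₜ* (D𝒢.chart h39𝒢.toProp36Hypotheses.isCountable hcof𝒢 h39𝒢.toProp36Hypotheses.isConnected hS𝒢 hfin𝒢 hne𝒢).G), IsVerticialHom (D𝒢.chart h39𝒢.toProp36Hypotheses.isCountable hcof𝒢 h39𝒢.toProp36Hypotheses.isConnected hS𝒢 hfin𝒢 hne𝒢) v φ →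
      ∃ Φ : contMulAut (D𝒢.chart h39𝒢.toProp36Hypotheses.isCountable hcof𝒢 h39𝒢.toProp36Hypotheses.isConnected hS𝒢 hfin𝒢 hne𝒢).G, TopOut.mk _ Φ = ρ𝒢 a ∧
        ∃ φ' : 𝒢.Gv ((baseAct𝒢 a).hom.vertexMap v) →ₜ* (D𝒢.chart h39𝒢.toProp36Hypotheses.isCountable hcof𝒢 h39𝒢.toProp36Hypotheses.isConnected hS𝒢 hfin𝒢 hne𝒢).G,
          IsVerticialHom (D𝒢.chart h39𝒢.toProp36Hypotheses.isCountable hcof𝒢 h39𝒢.toProp36Hypotheses.isConnected hS𝒢 hfin𝒢 hne𝒢) ((baseAct𝒢 a).hom.vertexMap v) φ' ∧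
          ∃ x' : (D𝒢.chart h39𝒢.toProp36Hypotheses.isCountable hcof𝒢 h39𝒢.toProp36Hypotheses.isConnected hS𝒢 hfin𝒢 hne𝒢).G,
            Subgroup.map (Φ : MulAut (D𝒢.chart h39𝒢.toProp36Hypotheses.isCountable hcof𝒢 h39𝒢.toProp36Hypotheses.isConnected hS𝒢 hfin𝒢 hne𝒢).G).toMonoidHom φ.toMonoidHom.range =
              Subgroup.map (MulAut.conj x').toMonoidHom φ'.toMonoidHom.range ∧
            Subgroup.map (Φ : MulAut (D𝒢.chart h39𝒢.toProp36Hypotheses.isCountable hcof𝒢 h39𝒢.toProp36Hypotheses.isConnected hS𝒢 hfin𝒢 hne𝒢).G).toMonoidHom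
                (Subgroup.map φ.toMonoidHom (𝒢.branchSubgroup b v hb)) =
              Subgroup.map (MulAut.conj x').toMonoidHom
                (Subgroup.map φ'.toMonoidHom
                  (𝒢.branchSubgroup ((baseAct𝒢 a).hom.branchMap b) ((baseAct𝒢 a).hom.vertexMap v)
                    ((baseAct𝒢 a).hom.abuts_branchMap b v hb))))
    (w𝒢 : 𝒢.graph.Vertex)
    -- CHARACTERISTIC finite levels (abc-iut-L3-t9 E1): `ker π_n` is the characteristic open core of level `d𝒢 n`
    (d𝒢 : ℕ → ℕ) (hker𝒢 : ∀ n, (D𝒢.piLevelAut h39𝒢.toProp36Hypotheses.isCountable hconn𝒢 n).ker = charOpenCore (D𝒢.temperedPi h39𝒢.toProp36Hypotheses.isCountable) (d𝒢 n))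
    -- (I0v) for the tower `D𝒢`: every `𝒢_v` acts faithfully on the `v`-fibres of the levels (abc-iut-w4-d053's
    -- `faithfulV_ofOpenNormalSeq` at the prescribed open-normal / characteristic tower)
    (hfaithV𝒢 : ∀ (v : 𝒢.graph.Vertex) (h : 𝒢.Gv v),
      (∀ (n : ℕ) (x : ((D𝒢.S n).SV v).obj.V), ((D𝒢.S n).SV v).obj.ρ h x = x) → h = 1)
    -- `hK1′` REPLACED (the L3 lead's α92 wording): congruence-continuity of `ρ` at the deep tree levels with trivial
    -- base action nearby (`hCC`, Def 5.1 (i)(c)/(d) + Prop 5.2 (i)); `hself` DISCHARGED (abc-iut-w6-d117 p442489)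
    (n𝒢 : ℕ)
    (hCC𝒢 : ∀ n, n𝒢 ≤ n → ∃ U ∈ 𝓝 (1 : ↥𝔊.PA), ∀ a ∈ U, baseAct𝒢 a = 1 ∧
      ∃ φ : contMulAut (D𝒢.chart h39𝒢.toProp36Hypotheses.isCountable hcof𝒢 h39𝒢.toProp36Hypotheses.isConnected hS𝒢 hfin𝒢 hne𝒢).G, TopOut.mk (D𝒢.chart h39𝒢.toProp36Hypotheses.isCountable hcof𝒢 h39𝒢.toProp36Hypotheses.isConnected hS𝒢 hfin𝒢 hne𝒢).G φ = ρ𝒢 a ∧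
        ∀ y : (D𝒢.chart h39𝒢.toProp36Hypotheses.isCountable hcof𝒢 h39𝒢.toProp36Hypotheses.isConnected hS𝒢 hfin𝒢 hne𝒢).G, (φ : MulAut (D𝒢.chart h39𝒢.toProp36Hypotheses.isCountable hcof𝒢 h39𝒢.toProp36Hypotheses.isConnected hS𝒢 hfin𝒢 hne𝒢).G) y * y⁻¹ ∈ (D𝒢.projAut h39𝒢.toProp36Hypotheses.isCountable n).ker)
    -- the topology of `E` IS abc-iut-w6-d070's tempered level topology at the chart of the tower
    (hinst𝒢 : inst𝒢 = @arithLevelTopology 𝒢 (D𝒢.chart h39𝒢.toProp36Hypotheses.isCountable hcof𝒢 h39𝒢.toProp36Hypotheses.isConnected hS𝒢 hfin𝒢 hne𝒢) 𝔊.PA _ _ _ ρ𝒢 baseAct𝒢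
        (TemperedPiChart.firstCountableTopology_G (D𝒢.chart h39𝒢.toProp36Hypotheses.isCountable hcof𝒢 h39𝒢.toProp36Hypotheses.isConnected hS𝒢 hfin𝒢 hne𝒢)) h39𝒢.toProp36Hypotheses IsTempered.of_profinite (D𝒢.piPresentation h39𝒢.toProp36Hypotheses.isCountable T𝒢 R𝒢)
        (isArithCompatible_piPresentation_outerAction_of_branchPair_chart_of_finite D𝒢 h39𝒢.toProp36Hypotheses.isCountable hcof𝒢 h39𝒢.toProp36Hypotheses.isConnected hS𝒢 hfin𝒢 hne𝒢 T𝒢 R𝒢 ρ𝒢 baseAct𝒢 h39𝒢.thm37Hypotheses h39𝒢.isGraph hV𝒢 hBR𝒢) w𝒢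
        (D𝒢.isCompact_piPresentation_H h39𝒢.toProp36Hypotheses.isCountable T𝒢 R𝒢 w𝒢) (fun n => (D𝒢.projAut h39𝒢.toProp36Hypotheses.isCountable n).ker) (fun _ => MonoidHom.normal_ker _)
        (D𝒢.hKst_and_hLst_of_ker_piLevelAut_eq_charOpenCore h39𝒢.toProp36Hypotheses.isCountable hconn𝒢 T𝒢 R𝒢 ρ𝒢 (isArithCompatible_piPresentation_outerAction_of_branchPair_chart_of_finite D𝒢 h39𝒢.toProp36Hypotheses.isCountable hcof𝒢 h39𝒢.toProp36Hypotheses.isConnected hS𝒢 hfin𝒢 hne𝒢 T𝒢 R𝒢 ρ𝒢 baseAct𝒢 h39𝒢.thm37Hypotheses h39𝒢.isGraph hV𝒢 hBR𝒢) d𝒢 hker𝒢).1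
        (D𝒢.ker_projAut_anti h39𝒢.toProp36Hypotheses.isCountable) (D𝒢.isOpen_ker_projAut h39𝒢.toProp36Hypotheses.isCountable) (fun _ hU => D𝒢.exists_ker_projAut_subset h39𝒢.toProp36Hypotheses.isCountable hU)
        (D𝒢.hK1'_chart_of_eventually_congruenceContinuous h39𝒢.thm37Hypotheses hcof𝒢 h39𝒢.toProp36Hypotheses.isConnected hS𝒢 hfin𝒢 hne𝒢 T𝒢 R𝒢 hconn𝒢 ρ𝒢 baseAct𝒢
          (isArithCompatible_piPresentation_outerAction_of_branchPair_chart_of_finite D𝒢 h39𝒢.toProp36Hypotheses.isCountable hcof𝒢 h39𝒢.toProp36Hypotheses.isConnected hS𝒢 hfin𝒢 hne𝒢 T𝒢 R𝒢 ρ𝒢 baseAct𝒢 h39𝒢.thm37Hypotheses h39𝒢.isGraph hV𝒢 hBR𝒢)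
          d𝒢 hker𝒢 h39𝒢.isGraph n𝒢 hCC𝒢))
    (noSwitch𝒢 : NoBranchSwitching 𝒢.graph.edgeOf
      (fun (a : 𝔊.PA) (b : 𝒢.graph.Branch) => (baseAct𝒢 a).hom.branchMap b))
    -- (AI4″) via abc-iut-w4-d059's hcof-FREE producer: only the chart representatives read off the presentation remain
    (hRcV𝒢 : ∀ v, Rc𝒢.Hv v = (D𝒢.piPresentation h39𝒢.toProp36Hypotheses.isCountable T𝒢 R𝒢).H v)
    (hRcB𝒢 : ∀ b, Rc𝒢.Hb b = ((D𝒢.piPresentation h39𝒢.toProp36Hypotheses.isCountable T𝒢 R𝒢).M (𝒢.graph.edgeOf b)).map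
      (MulAut.conj ((D𝒢.piPresentation h39𝒢.toProp36Hypotheses.isCountable T𝒢 R𝒢).s b)).toMonoidHom)
    (hest𝒢 : IsTotallyArithEstranged (decompositionDataOfChart Rc𝒢 (toOuterSemidirectProduct ρ𝒢)) (outerSemidirectProductSnd ρ𝒢)) (hbot𝒢 : ¬ IsArithAmple (outerSemidirectProductSnd ρ𝒢) ⊥)
    -- ── the ℍ′ side: a cofinal Galois tower with characteristic levels, its chart, the outer model over `Π_{A′}` ──
    (h39ℋ : Cor39Hypotheses ℋ) (Dℋ : GaloisLevelData ℋ)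
    (hcofℋ : ∀ (X : CovObj ℋ), X.IsTempered → ∀ p : X.Point, ∃ i : ℕ, ∀ j, i ≤ j → (Dℋ.S j).Splits (X.component p))
    (hSℋ : ∀ n, (Dℋ.S n).Splits (Dℋ.S n)) (hfinℋ : ∀ n, (Dℋ.S n).IsFinite) (hneℋ : ∀ n, (Dℋ.S n).HasNonemptyFibres)
    (hconnℋ : ∀ (n : ℕ) (p q : (Dℋ.S n).Point), (Dℋ.S n).SameComponent p q)
    [Finite ℋ.graph.Vertex] [Finite ℋ.graph.Branch]
    [Finite ℋ.graph.Edge]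
    (ρℋ : ℍ.PA →* TopOut (Dℋ.chart h39ℋ.toProp36Hypotheses.isCountable hcofℋ h39ℋ.toProp36Hypotheses.isConnected hSℋ hfinℋ hneℋ).G) (baseActℋ : ℍ.PA →* Aut ℋ.graph)
    [instℋ : TopologicalSpace (outerSemidirectProduct ρℋ)]
    (Tℋ : ∀ w : ℋ.graph.Vertex, Dℋ.PointSeq h39ℋ.toProp36Hypotheses.isCountable w) (Rℋ : SemiGraph.RefBranches ℋ.graph)
    (Rcℋ : ChartRepresentatives (Dℋ.chart h39ℋ.toProp36Hypotheses.isCountable hcofℋ h39ℋ.toProp36Hypotheses.isConnected hSℋ hfinℋ hneℋ))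
    -- Prop 3.6 (iv) at `ρ_𝔾(a)` / Def 5.1 (i)(c): the DESIGN data of the outer model (abc-iut-w4-d082's currency)
    (hVℋ : ∀ (a : ℍ.PA) (v : ℋ.graph.Vertex) (H : Subgroup (Dℋ.chart h39ℋ.toProp36Hypotheses.isCountable hcofℋ h39ℋ.toProp36Hypotheses.isConnected hSℋ hfinℋ hneℋ).G), H ∈ verticialSubgroups (Dℋ.chart h39ℋ.toProp36Hypotheses.isCountable hcofℋ h39ℋ.toProp36Hypotheses.isConnected hSℋ hfinℋ hneℋ) v →
      ∃ φ : contMulAut (Dℋ.chart h39ℋ.toProp36Hypotheses.isCountable hcofℋ h39ℋ.toProp36Hypotheses.isConnected hSℋ hfinℋ hneℋ).G, TopOut.mk _ φ = ρℋ a ∧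
        H.map (φ : MulAut (Dℋ.chart h39ℋ.toProp36Hypotheses.isCountable hcofℋ h39ℋ.toProp36Hypotheses.isConnected hSℋ hfinℋ hneℋ).G).toMonoidHom ∈ verticialSubgroups (Dℋ.chart h39ℋ.toProp36Hypotheses.isCountable hcofℋ h39ℋ.toProp36Hypotheses.isConnected hSℋ hfinℋ hneℋ) ((baseActℋ a).hom.vertexMap v))
    (hEℋ : ∀ (a : ℍ.PA) (e : ℋ.graph.Edge) (K : Subgroup (Dℋ.chart h39ℋ.toProp36Hypotheses.isCountable hcofℋ h39ℋ.toProp36Hypotheses.isConnected hSℋ hfinℋ hneℋ).G), K ∈ edgeLikeSubgroups (Dℋ.chart h39ℋ.toProp36Hypotheses.isCountable hcofℋ h39ℋ.toProp36Hypotheses.isConnected hSℋ hfinℋ hneℋ) e →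
      ∃ φ : contMulAut (Dℋ.chart h39ℋ.toProp36Hypotheses.isCountable hcofℋ h39ℋ.toProp36Hypotheses.isConnected hSℋ hfinℋ hneℋ).G, TopOut.mk _ φ = ρℋ a ∧
        K.map (φ : MulAut (Dℋ.chart h39ℋ.toProp36Hypotheses.isCountable hcofℋ h39ℋ.toProp36Hypotheses.isConnected hSℋ hfinℋ hneℋ).G).toMonoidHom ∈ edgeLikeSubgroups (Dℋ.chart h39ℋ.toProp36Hypotheses.isCountable hcofℋ h39ℋ.toProp36Hypotheses.isConnected hSℋ hfinℋ hneℋ) ((baseActℋ a).hom.edgeMap e))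
    (hopenℋ : ∃ U : Subgroup ℍ.PA, IsOpen (U : Set ℍ.PA) ∧ ∀ a ∈ U,
      (∀ v, (baseActℋ a).hom.vertexMap v = v) ∧ (∀ e, (baseActℋ a).hom.edgeMap e = e) ∧
        ∀ b, (baseActℋ a).hom.branchMap b = b)
    (hBRℋ : ∀ (a : ℍ.PA) (b : ℋ.graph.Branch) (v : ℋ.graph.Vertex) (hb : ℋ.graph.abuts b = some v)
      (φ : ℋ.Gv v →ₜ* (Dℋ.chart h39ℋ.toProp36Hypotheses.isCountable hcofℋ h39ℋ.toProp36Hypotheses.isConnected hSℋ hfinℋ hneℋ).G), IsVerticialHom (Dℋ.chart h39ℋ.toProp36Hypotheses.isCountable hcofℋ h39ℋ.toProp36Hypotheses.isConnected hSℋ hfinℋ hneℋ) v φ →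
      ∃ Φ : contMulAut (Dℋ.chart h39ℋ.toProp36Hypotheses.isCountable hcofℋ h39ℋ.toProp36Hypotheses.isConnected hSℋ hfinℋ hneℋ).G, TopOut.mk _ Φ = ρℋ a ∧
        ∃ φ' : ℋ.Gv ((baseActℋ a).hom.vertexMap v) →ₜ* (Dℋ.chart h39ℋ.toProp36Hypotheses.isCountable hcofℋ h39ℋ.toProp36Hypotheses.isConnected hSℋ hfinℋ hneℋ).G,
          IsVerticialHom (Dℋ.chart h39ℋ.toProp36Hypotheses.isCountable hcofℋ h39ℋ.toProp36Hypotheses.isConnected hSℋ hfinℋ hneℋ) ((baseActℋ a).hom.vertexMap v) φ' ∧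
          ∃ x' : (Dℋ.chart h39ℋ.toProp36Hypotheses.isCountable hcofℋ h39ℋ.toProp36Hypotheses.isConnected hSℋ hfinℋ hneℋ).G,
            Subgroup.map (Φ : MulAut (Dℋ.chart h39ℋ.toProp36Hypotheses.isCountable hcofℋ h39ℋ.toProp36Hypotheses.isConnected hSℋ hfinℋ hneℋ).G).toMonoidHom φ.toMonoidHom.range =
              Subgroup.map (MulAut.conj x').toMonoidHom φ'.toMonoidHom.range ∧
            Subgroup.map (Φ : MulAut (Dℋ.chart h39ℋ.toProp36Hypotheses.isCountable hcofℋ h39ℋ.toProp36Hypotheses.isConnected hSℋ hfinℋ hneℋ).G).toMonoidHom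
                (Subgroup.map φ.toMonoidHom (ℋ.branchSubgroup b v hb)) =
              Subgroup.map (MulAut.conj x').toMonoidHom
                (Subgroup.map φ'.toMonoidHom
                  (ℋ.branchSubgroup ((baseActℋ a).hom.branchMap b) ((baseActℋ a).hom.vertexMap v)
                    ((baseActℋ a).hom.abuts_branchMap b v hb))))
    (wℋ : ℋ.graph.Vertex)
    -- CHARACTERISTIC finite levels (abc-iut-L3-t9 E1): `ker π_n` is the characteristic open core of level `dℋ n`
    (dℋ : ℕ → ℕ) (hkerℋ : ∀ n, (Dℋ.piLevelAut h39ℋ.toProp36Hypotheses.isCountable hconnℋ n).ker = charOpenCore (Dℋ.temperedPi h39ℋ.toProp36Hypotheses.isCountable) (dℋ n))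
    -- (I0v) for the tower `Dℋ`: every `ℋ_v` acts faithfully on the `v`-fibres of the levels (abc-iut-w4-d053's
    -- `faithfulV_ofOpenNormalSeq` at the prescribed open-normal / characteristic tower)
    (hfaithVℋ : ∀ (v : ℋ.graph.Vertex) (h : ℋ.Gv v),
      (∀ (n : ℕ) (x : ((Dℋ.S n).SV v).obj.V), ((Dℋ.S n).SV v).obj.ρ h x = x) → h = 1)
    -- `hK1′` REPLACED (the L3 lead's α92 wording): congruence-continuity of `ρ` at the deep tree levels with trivial
    -- base action nearby (`hCC`, Def 5.1 (i)(c)/(d) + Prop 5.2 (i)); `hself` DISCHARGED (abc-iut-w6-d117 p442489)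
    (nℋ : ℕ)
    (hCCℋ : ∀ n, nℋ ≤ n → ∃ U ∈ 𝓝 (1 : ↥ℍ.PA), ∀ a ∈ U, baseActℋ a = 1 ∧
      ∃ φ : contMulAut (Dℋ.chart h39ℋ.toProp36Hypotheses.isCountable hcofℋ h39ℋ.toProp36Hypotheses.isConnected hSℋ hfinℋ hneℋ).G, TopOut.mk (Dℋ.chart h39ℋ.toProp36Hypotheses.isCountable hcofℋ h39ℋ.toProp36Hypotheses.isConnected hSℋ hfinℋ hneℋ).G φ = ρℋ a ∧
        ∀ y : (Dℋ.chart h39ℋ.toProp36Hypotheses.isCountable hcofℋ h39ℋ.toProp36Hypotheses.isConnected hSℋ hfinℋ hneℋ).G, (φ : MulAut (Dℋ.chart h39ℋ.toProp36Hypotheses.isCountable hcofℋ h39ℋ.toProp36Hypotheses.isConnected hSℋ hfinℋ hneℋ).G) y * y⁻¹ ∈ (Dℋ.projAut h39ℋ.toProp36Hypotheses.isCountable n).ker)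
    -- the topology of `E` IS abc-iut-w6-d070's tempered level topology at the chart of the tower
    (hinstℋ : instℋ = @arithLevelTopology ℋ (Dℋ.chart h39ℋ.toProp36Hypotheses.isCountable hcofℋ h39ℋ.toProp36Hypotheses.isConnected hSℋ hfinℋ hneℋ) ℍ.PA _ _ _ ρℋ baseActℋ
        (TemperedPiChart.firstCountableTopology_G (Dℋ.chart h39ℋ.toProp36Hypotheses.isCountable hcofℋ h39ℋ.toProp36Hypotheses.isConnected hSℋ hfinℋ hneℋ)) h39ℋ.toProp36Hypotheses IsTempered.of_profinite (Dℋ.piPresentation h39ℋ.toProp36Hypotheses.isCountable Tℋ Rℋ)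
        (isArithCompatible_piPresentation_outerAction_of_branchPair_chart_of_finite Dℋ h39ℋ.toProp36Hypotheses.isCountable hcofℋ h39ℋ.toProp36Hypotheses.isConnected hSℋ hfinℋ hneℋ Tℋ Rℋ ρℋ baseActℋ h39ℋ.thm37Hypotheses h39ℋ.isGraph hVℋ hBRℋ) wℋ
        (Dℋ.isCompact_piPresentation_H h39ℋ.toProp36Hypotheses.isCountable Tℋ Rℋ wℋ) (fun n => (Dℋ.projAut h39ℋ.toProp36Hypotheses.isCountable n).ker) (fun _ => MonoidHom.normal_ker _)
        (Dℋ.hKst_and_hLst_of_ker_piLevelAut_eq_charOpenCore h39ℋ.toProp36Hypotheses.isCountable hconnℋ Tℋ Rℋ ρℋ (isArithCompatible_piPresentation_outerAction_of_branchPair_chart_of_finite Dℋ h39ℋ.toProp36Hypotheses.isCountable hcofℋ h39ℋ.toProp36Hypotheses.isConnected hSℋ hfinℋ hneℋ Tℋ Rℋ ρℋ baseActℋ h39ℋ.thm37Hypotheses h39ℋ.isGraph hVℋ hBRℋ) dℋ hkerℋ).1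
        (Dℋ.ker_projAut_anti h39ℋ.toProp36Hypotheses.isCountable) (Dℋ.isOpen_ker_projAut h39ℋ.toProp36Hypotheses.isCountable) (fun _ hU => Dℋ.exists_ker_projAut_subset h39ℋ.toProp36Hypotheses.isCountable hU)
        (Dℋ.hK1'_chart_of_eventually_congruenceContinuous h39ℋ.thm37Hypotheses hcofℋ h39ℋ.toProp36Hypotheses.isConnected hSℋ hfinℋ hneℋ Tℋ Rℋ hconnℋ ρℋ baseActℋ
          (isArithCompatible_piPresentation_outerAction_of_branchPair_chart_of_finite Dℋ h39ℋ.toProp36Hypotheses.isCountable hcofℋ h39ℋ.toProp36Hypotheses.isConnected hSℋ hfinℋ hneℋ Tℋ Rℋ ρℋ baseActℋ h39ℋ.thm37Hypotheses h39ℋ.isGraph hVℋ hBRℋ)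
          dℋ hkerℋ h39ℋ.isGraph nℋ hCCℋ))
    (noSwitchℋ : NoBranchSwitching ℋ.graph.edgeOf
      (fun (a : ℍ.PA) (b : ℋ.graph.Branch) => (baseActℋ a).hom.branchMap b))
    -- (AI4″) via abc-iut-w4-d059's hcof-FREE producer: only the chart representatives read off the presentation remain
    (hRcVℋ : ∀ v, Rcℋ.Hv v = (Dℋ.piPresentation h39ℋ.toProp36Hypotheses.isCountable Tℋ Rℋ).H v)
    (hRcBℋ : ∀ b, Rcℋ.Hb b = ((Dℋ.piPresentation h39ℋ.toProp36Hypotheses.isCountable Tℋ Rℋ).M (ℋ.graph.edgeOf b)).map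
      (MulAut.conj ((Dℋ.piPresentation h39ℋ.toProp36Hypotheses.isCountable Tℋ Rℋ).s b)).toMonoidHom)
    (hestℋ : IsTotallyArithEstranged (decompositionDataOfChart Rcℋ (toOuterSemidirectProduct ρℋ)) (outerSemidirectProductSnd ρℋ)) (hbotℋ : ¬ IsArithAmple (outerSemidirectProductSnd ρℋ) ⊥)
    -- ── Thm 5.4 (iii): the arithmetic `B^temp`, the dictionary, the represented graph actions (design) ──
    -- (D1)/(D2): the dictionary of arrows with chosen 2-cells and its chart-level representatives (verbatim)
    (dict : (𝔊.G ⟶ ℍ.G) → Hom 𝒢 ℋ) (θd : ∀ g, (dict g).ConjugatorFamily) (hlo : ∀ g, (dict g).IsLocallyOpen)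
    (φc : (𝔊.G ⟶ ℍ.G) → ((D𝒢.chart h39𝒢.toProp36Hypotheses.isCountable hcof𝒢 h39𝒢.toProp36Hypotheses.isConnected hS𝒢 hfin𝒢 hne𝒢).G →ₜ* (Dℋ.chart h39ℋ.toProp36Hypotheses.isCountable hcofℋ h39ℋ.toProp36Hypotheses.isConnected hSℋ hfinℋ hneℋ).G))
    (hφc : ∀ g, Nonempty ((dict g).chartPullbackWith (θd g) (D𝒢.chart h39𝒢.toProp36Hypotheses.isCountable hcof𝒢 h39𝒢.toProp36Hypotheses.isConnected hS𝒢 hfin𝒢 hne𝒢) (Dℋ.chart h39ℋ.toProp36Hypotheses.isCountable hcofℋ h39ℋ.toProp36Hypotheses.isConnected hSℋ hfinℋ hneℋ) ≅ BTemp.res (φc g)))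
    (hfaith : ∀ g₁ g₂ : 𝔊.G ⟶ ℍ.G, Nonempty ((dict g₁).chartPullbackWith (θd g₁) (D𝒢.chart h39𝒢.toProp36Hypotheses.isCountable hcof𝒢 h39𝒢.toProp36Hypotheses.isConnected hS𝒢 hfin𝒢 hne𝒢) (Dℋ.chart h39ℋ.toProp36Hypotheses.isCountable hcofℋ h39ℋ.toProp36Hypotheses.isConnected hSℋ hfinℋ hneℋ) ≅
      (dict g₂).chartPullbackWith (θd g₂) (D𝒢.chart h39𝒢.toProp36Hypotheses.isCountable hcof𝒢 h39𝒢.toProp36Hypotheses.isConnected hS𝒢 hfin𝒢 hne𝒢) (Dℋ.chart h39ℋ.toProp36Hypotheses.isCountable hcofℋ h39ℋ.toProp36Hypotheses.isConnected hSℋ hfinℋ hneℋ)) → g₁ = g₂)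
    (hfull : ∀ F : Hom 𝒢 ℋ, F.IsLocallyOpen → ∀ θ : F.ConjugatorFamily,
      ∃ g : 𝔊.G ⟶ ℍ.G, Nonempty ((dict g).chartPullbackWith (θd g) (D𝒢.chart h39𝒢.toProp36Hypotheses.isCountable hcof𝒢 h39𝒢.toProp36Hypotheses.isConnected hS𝒢 hfin𝒢 hne𝒢) (Dℋ.chart h39ℋ.toProp36Hypotheses.isCountable hcofℋ h39ℋ.toProp36Hypotheses.isConnected hSℋ hfinℋ hneℋ) ≅ F.chartPullbackWith θ (D𝒢.chart h39𝒢.toProp36Hypotheses.isCountable hcof𝒢 h39𝒢.toProp36Hypotheses.isConnected hS𝒢 hfin𝒢 hne𝒢) (Dℋ.chart h39ℋ.toProp36Hypotheses.isCountable hcofℋ h39ℋ.toProp36Hypotheses.isConnected hSℋ hfinℋ hneℋ)))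
    -- (D1a)/(D1b): the graph actions of `Π_A` on `𝔾` and of `Π_{A′}` on `ℍ′` with chosen 2-cells, REPRESENTED at
    -- the outer actions (abc-iut-w5-d141's `hrep` currency), and the functoriality of the dictionary
    (F𝒢 : 𝔊.PA → Hom 𝒢 𝒢) (θ𝒢 : ∀ a, (F𝒢 a).ConjugatorFamily)
    (hrep𝒢 : ∀ a, ∃ (Φ : contMulAut (D𝒢.chart h39𝒢.toProp36Hypotheses.isCountable hcof𝒢 h39𝒢.toProp36Hypotheses.isConnected hS𝒢 hfin𝒢 hne𝒢).G) (φ : (D𝒢.chart h39𝒢.toProp36Hypotheses.isCountable hcof𝒢 h39𝒢.toProp36Hypotheses.isConnected hS𝒢 hfin𝒢 hne𝒢).G →ₜ* (D𝒢.chart h39𝒢.toProp36Hypotheses.isCountable hcof𝒢 h39𝒢.toProp36Hypotheses.isConnected hS𝒢 hfin𝒢 hne𝒢).G), TopOut.mk (D𝒢.chart h39𝒢.toProp36Hypotheses.isCountable hcof𝒢 h39𝒢.toProp36Hypotheses.isConnected hS𝒢 hfin𝒢 hne𝒢).G Φ = ρ𝒢 a ∧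
      (∀ t, (Φ : MulAut (D𝒢.chart h39𝒢.toProp36Hypotheses.isCountable hcof𝒢 h39𝒢.toProp36Hypotheses.isConnected hS𝒢 hfin𝒢 hne𝒢).G) t = φ t) ∧ Nonempty ((F𝒢 a).chartPullbackWith (θ𝒢 a) (D𝒢.chart h39𝒢.toProp36Hypotheses.isCountable hcof𝒢 h39𝒢.toProp36Hypotheses.isConnected hS𝒢 hfin𝒢 hne𝒢) (D𝒢.chart h39𝒢.toProp36Hypotheses.isCountable hcof𝒢 h39𝒢.toProp36Hypotheses.isConnected hS𝒢 hfin𝒢 hne𝒢) ≅ BTemp.res φ))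
    (hpre : ∀ (a : 𝔊.PA) (g : 𝔊.G ⟶ ℍ.G),
      Nonempty ((dict ((𝔊.ρ a).hom ≫ g)).chartPullbackWith (θd ((𝔊.ρ a).hom ≫ g)) (D𝒢.chart h39𝒢.toProp36Hypotheses.isCountable hcof𝒢 h39𝒢.toProp36Hypotheses.isConnected hS𝒢 hfin𝒢 hne𝒢) (Dℋ.chart h39ℋ.toProp36Hypotheses.isCountable hcofℋ h39ℋ.toProp36Hypotheses.isConnected hSℋ hfinℋ hneℋ) ≅
        (dict g).chartPullbackWith (θd g) (D𝒢.chart h39𝒢.toProp36Hypotheses.isCountable hcof𝒢 h39𝒢.toProp36Hypotheses.isConnected hS𝒢 hfin𝒢 hne𝒢) (Dℋ.chart h39ℋ.toProp36Hypotheses.isCountable hcofℋ h39ℋ.toProp36Hypotheses.isConnected hSℋ hfinℋ hneℋ) ⋙ (F𝒢 a).chartPullbackWith (θ𝒢 a) (D𝒢.chart h39𝒢.toProp36Hypotheses.isCountable hcof𝒢 h39𝒢.toProp36Hypotheses.isConnected hS𝒢 hfin𝒢 hne𝒢) (D𝒢.chart h39𝒢.toProp36Hypotheses.isCountable hcof𝒢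 h39𝒢.toProp36Hypotheses.isConnected hS𝒢 hfin𝒢 hne𝒢)))
    (Fℋ : ℍ.PA → Hom ℋ ℋ) (θℋ : ∀ a, (Fℋ a).ConjugatorFamily)
    (hrepℋ : ∀ a, ∃ (Φ : contMulAut (Dℋ.chart h39ℋ.toProp36Hypotheses.isCountable hcofℋ h39ℋ.toProp36Hypotheses.isConnected hSℋ hfinℋ hneℋ).G) (φ : (Dℋ.chart h39ℋ.toProp36Hypotheses.isCountable hcofℋ h39ℋ.toProp36Hypotheses.isConnected hSℋ hfinℋ hneℋ).G →ₜ* (Dℋ.chart h39ℋ.toProp36Hypotheses.isCountable hcofℋ h39ℋ.toProp36Hypotheses.isConnected hSℋ hfinℋ hneℋ).G), TopOut.mk (Dℋ.chart h39ℋ.toProp36Hypotheses.isCountable hcofℋ h39ℋ.toProp36Hypotheses.isConnected hSℋ hfinℋ hneℋ).G Φ = ρℋ a ∧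
      (∀ t, (Φ : MulAut (Dℋ.chart h39ℋ.toProp36Hypotheses.isCountable hcofℋ h39ℋ.toProp36Hypotheses.isConnected hSℋ hfinℋ hneℋ).G) t = φ t) ∧ Nonempty ((Fℋ a).chartPullbackWith (θℋ a) (Dℋ.chart h39ℋ.toProp36Hypotheses.isCountable hcofℋ h39ℋ.toProp36Hypotheses.isConnected hSℋ hfinℋ hneℋ) (Dℋ.chart h39ℋ.toProp36Hypotheses.isCountable hcofℋ h39ℋ.toProp36Hypotheses.isConnected hSℋ hfinℋ hneℋ) ≅ BTemp.res φ))
    (hpost : ∀ (a : ℍ.PA) (g : 𝔊.G ⟶ ℍ.G),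
      Nonempty ((dict (g ≫ (ℍ.ρ a).hom)).chartPullbackWith (θd (g ≫ (ℍ.ρ a).hom)) (D𝒢.chart h39𝒢.toProp36Hypotheses.isCountable hcof𝒢 h39𝒢.toProp36Hypotheses.isConnected hS𝒢 hfin𝒢 hne𝒢) (Dℋ.chart h39ℋ.toProp36Hypotheses.isCountable hcofℋ h39ℋ.toProp36Hypotheses.isConnected hSℋ hfinℋ hneℋ) ≅
        (Fℋ a).chartPullbackWith (θℋ a) (Dℋ.chart h39ℋ.toProp36Hypotheses.isCountable hcofℋ h39ℋ.toProp36Hypotheses.isConnected hSℋ hfinℋ hneℋ) (Dℋ.chart h39ℋ.toProp36Hypotheses.isCountable hcofℋ h39ℋ.toProp36Hypotheses.isConnected hSℋ hfinℋ hneℋ) ⋙ (dict g).chartPullbackWith (θd g) (D𝒢.chart h39𝒢.toProp36Hypotheses.isCountable hcof𝒢 h39𝒢.toProp36Hypotheses.isConnected hS𝒢 hfin𝒢 hne𝒢) (Dℋ.chart h39ℋ.toProp36Hypotheses.isCountable hcofℋ h39ℋ.toProp36Hypotheses.isConnected hSℋ hfinℋ hneℋ)))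
    -- (`hcont` — the continuity of the canonical `B^temp(φ)` — is NO LONGER a binder: abc-iut-w4-d089's
    -- `continuous_outerSemidirectProductMap_arithLevelTopology` discharges it below)
    -- the conclusion is exported at ARBITRARY representatives (abc-iut-w4-d059's Rc-invariance p446096/p447014)
    (Rc'𝒢 : ChartRepresentatives (D𝒢.chart h39𝒢.toProp36Hypotheses.isCountable hcof𝒢 h39𝒢.toProp36Hypotheses.isConnected hS𝒢 hfin𝒢 hne𝒢)) (Rc'ℋ : ChartRepresentatives (Dℋ.chart h39ℋ.toProp36Hypotheses.isCountable hcofℋ h39ℋ.toProp36Hypotheses.isConnected hSℋ hfinℋ hneℋ))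
    (he : Continuous e) :
    (ArithMaximalCompactStatementI (decompositionDataOfChart Rc'𝒢 (toOuterSemidirectProduct ρ𝒢)) (outerSemidirectProductSnd ρ𝒢) ∧
      ArithMaximalCompactStatementII (decompositionDataOfChart Rc'𝒢 (toOuterSemidirectProduct ρ𝒢)) (outerSemidirectProductSnd ρ𝒢)) ∧
    (ArithMaximalCompactStatementI (decompositionDataOfChart Rc'ℋ (toOuterSemidirectProduct ρℋ)) (outerSemidirectProductSnd ρℋ) ∧
      ArithMaximalCompactStatementII (decompositionDataOfChart Rc'ℋ (toOuterSemidirectProduct ρℋ)) (outerSemidirectProductSnd ρℋ)) ∧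
    Literature.AnabelianGeometry.SemiGraphs.ArithQuasiGeometricCorrespondenceStatementCompat 𝔊 ℍ e
      (outerSemidirectProductSnd ρ𝒢) (outerSemidirectProductSnd ρℋ)
      (fun φ _ h₂ => outerSemidirectProductMap ρ𝒢 ρℋ e.toMonoidHom (φc φ.geom).toMonoidHom (compat_of_representatives ρ𝒢 ρℋ e.toMonoidHom (φc φ.geom).toMonoidHom
          (btemp_representatives_of_dict (D𝒢.chart h39𝒢.toProp36Hypotheses.isCountable hcof𝒢 h39𝒢.toProp36Hypotheses.isConnected hS𝒢 hfin𝒢 hne𝒢) (Dℋ.chart h39ℋ.toProp36Hypotheses.isCountable hcofℋ h39ℋ.toProp36Hypotheses.isConnected hSℋ hfinℋ hneℋ) ρ𝒢 ρℋ e.toMonoidHom F𝒢 θ𝒢 (fun a => Fℋ (e a)) (fun a => θℋ (e a))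
            hrep𝒢 (fun a => hrepℋ (e a)) dict θd φc hφc (fun a g => (𝔊.ρ a).hom ≫ g) (fun a g => g ≫ (ℍ.ρ (e a)).hom)
            hpre (fun a g => hpost (e a) g) φ.geom (fun a => (φ.compat a).trans (by rw [h₂ a])))) (centraliserFree_of_chartPullbackWith_iso h39𝒢.thm37Hypotheses h39ℋ.thm37Hypotheses (D𝒢.chart h39𝒢.toProp36Hypotheses.isCountable hcof𝒢 h39𝒢.toProp36Hypotheses.isConnected hS𝒢 hfin𝒢 hne𝒢) (Dℋ.chart h39ℋ.toProp36Hypotheses.isCountable hcofℋ h39ℋ.toProp36Hypotheses.isConnected hSℋ hfinℋ hneℋ) (dict φ.geom) (θd φ.geom) (hlo φ.geom) (φc φ.geom) (hφc φ.geom))) := by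
  -- the per-side terms pinned by the topology equations (verbatim from v5)
  have hP𝒢' := isArithCompatible_piPresentation_outerAction_of_branchPair_chart_of_finite D𝒢 h39𝒢.toProp36Hypotheses.isCountable hcof𝒢 h39𝒢.toProp36Hypotheses.isConnected hS𝒢 hfin𝒢 hne𝒢 T𝒢 R𝒢 ρ𝒢 baseAct𝒢 h39𝒢.thm37Hypotheses h39𝒢.isGraph hV𝒢 hBR𝒢
  have hKL𝒢' := D𝒢.hKst_and_hLst_of_ker_piLevelAut_eq_charOpenCore h39𝒢.toProp36Hypotheses.isCountable hconn𝒢 T𝒢 R𝒢 ρ𝒢 hP𝒢' d𝒢 hker𝒢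
  have hK1𝒢' := D𝒢.hK1'_chart_of_eventually_congruenceContinuous h39𝒢.thm37Hypotheses hcof𝒢 h39𝒢.toProp36Hypotheses.isConnected hS𝒢 hfin𝒢 hne𝒢 T𝒢 R𝒢 hconn𝒢 ρ𝒢 baseAct𝒢
    hP𝒢' d𝒢 hker𝒢 h39𝒢.isGraph n𝒢 hCC𝒢
  have hcpt𝒢' := D𝒢.isCompact_piPresentation_H h39𝒢.toProp36Hypotheses.isCountable T𝒢 R𝒢 w𝒢
  have hPℋ' := isArithCompatible_piPresentation_outerAction_of_branchPair_chart_of_finite Dℋ h39ℋ.toProp36Hypotheses.isCountable hcofℋ h39ℋ.toProp36Hypotheses.isConnected hSℋ hfinℋ hneℋ Tℋ Rℋ ρℋ baseActℋ h39ℋ.thm37Hypotheses h39ℋ.isGraph hVℋ hBRℋ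
  have hKLℋ' := Dℋ.hKst_and_hLst_of_ker_piLevelAut_eq_charOpenCore h39ℋ.toProp36Hypotheses.isCountable hconnℋ Tℋ Rℋ ρℋ hPℋ' dℋ hkerℋ
  have hK1ℋ' := Dℋ.hK1'_chart_of_eventually_congruenceContinuous h39ℋ.thm37Hypotheses hcofℋ h39ℋ.toProp36Hypotheses.isConnected hSℋ hfinℋ hneℋ Tℋ Rℋ hconnℋ ρℋ baseActℋ
    hPℋ' dℋ hkerℋ h39ℋ.isGraph nℋ hCCℋ
  have hcptℋ' := Dℋ.isCompact_piPresentation_H h39ℋ.toProp36Hypotheses.isCountable Tℋ Rℋ wℋ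
  haveI hfc𝒢 : FirstCountableTopology (D𝒢.chart h39𝒢.toProp36Hypotheses.isCountable hcof𝒢 h39𝒢.toProp36Hypotheses.isConnected hS𝒢 hfin𝒢 hne𝒢).G := TemperedPiChart.firstCountableTopology_G _
  haveI hfcℋ : FirstCountableTopology (Dℋ.chart h39ℋ.toProp36Hypotheses.isCountable hcofℋ h39ℋ.toProp36Hypotheses.isConnected hSℋ hfinℋ hneℋ).G := TemperedPiChart.firstCountableTopology_G _
  -- the presentation vertex groups are §3 verticial subgroups (the vertex link of the continuity theorem)
  have hPH𝒢 : ∀ w', (D𝒢.piPresentation h39𝒢.toProp36Hypotheses.isCountable T𝒢 R𝒢).H w' ∈ verticialSubgroups (D𝒢.chart h39𝒢.toProp36Hypotheses.isCountable hcof𝒢 h39𝒢.toProp36Hypotheses.isConnected hS𝒢 hfin𝒢 hne𝒢) w' := fun w' => by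
    rw [D𝒢.piPresentation_H h39𝒢.toProp36Hypotheses.isCountable T𝒢 R𝒢]
    exact (T𝒢 w').range_decompHom_mem_verticialSubgroups_chart hcof𝒢 h39𝒢.toProp36Hypotheses.isConnected hS𝒢 hfin𝒢 hne𝒢
  have hPHℋ : ∀ w', (Dℋ.piPresentation h39ℋ.toProp36Hypotheses.isCountable Tℋ Rℋ).H w' ∈ verticialSubgroups (Dℋ.chart h39ℋ.toProp36Hypotheses.isCountable hcofℋ h39ℋ.toProp36Hypotheses.isConnected hSℋ hfinℋ hneℋ) w' := fun w' => by
    rw [Dℋ.piPresentation_H h39ℋ.toProp36Hypotheses.isCountable Tℋ Rℋ]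
    exact (Tℋ w').range_decompHom_mem_verticialSubgroups_chart hcofℋ h39ℋ.toProp36Hypotheses.isConnected hSℋ hfinℋ hneℋ
  subst hinst𝒢 hinstℋ
  letI : TopologicalSpace (outerSemidirectProduct ρ𝒢) := arithLevelTopology (D𝒢.chart h39𝒢.toProp36Hypotheses.isCountable hcof𝒢 h39𝒢.toProp36Hypotheses.isConnected hS𝒢 hfin𝒢 hne𝒢) ρ𝒢 baseAct𝒢 h39𝒢.toProp36Hypotheses IsTempered.of_profinite (D𝒢.piPresentation h39𝒢.toProp36Hypotheses.isCountable T𝒢 R𝒢) hP𝒢' w𝒢 hcpt𝒢'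
      (fun n => (D𝒢.projAut h39𝒢.toProp36Hypotheses.isCountable n).ker) (fun _ => MonoidHom.normal_ker _) hKL𝒢'.1 (D𝒢.ker_projAut_anti h39𝒢.toProp36Hypotheses.isCountable)
      (D𝒢.isOpen_ker_projAut h39𝒢.toProp36Hypotheses.isCountable) (fun _ hU => D𝒢.exists_ker_projAut_subset h39𝒢.toProp36Hypotheses.isCountable hU) hK1𝒢'
  letI : TopologicalSpace (outerSemidirectProduct ρℋ) := arithLevelTopology (Dℋ.chart h39ℋ.toProp36Hypotheses.isCountable hcofℋ h39ℋ.toProp36Hypotheses.isConnected hSℋ hfinℋ hneℋ) ρℋ baseActℋ h39ℋ.toProp36Hypotheses IsTempered.of_profinite (Dℋ.piPresentation h39ℋ.toProp36Hypotheses.isCountable Tℋ Rℋ) hPℋ' wℋ hcptℋ'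
      (fun n => (Dℋ.projAut h39ℋ.toProp36Hypotheses.isCountable n).ker) (fun _ => MonoidHom.normal_ker _) hKLℋ'.1 (Dℋ.ker_projAut_anti h39ℋ.toProp36Hypotheses.isCountable)
      (Dℋ.isOpen_ker_projAut h39ℋ.toProp36Hypotheses.isCountable) (fun _ hU => Dℋ.exists_ker_projAut_subset h39ℋ.toProp36Hypotheses.isCountable hU) hK1ℋ'
  exact arithThm54_outerModels_chart_of_producers_anyRepresentatives h39𝒢 D𝒢 hcof𝒢 hS𝒢 hfin𝒢 hne𝒢 hconn𝒢 ρ𝒢 baseAct𝒢 T𝒢 R𝒢 Rc𝒢 hV𝒢 hE𝒢 hopen𝒢 hBR𝒢 w𝒢 d𝒢 hker𝒢 hfaithV𝒢 n𝒢 hCC𝒢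
    rfl noSwitch𝒢 hRcV𝒢 hRcB𝒢 hest𝒢 hbot𝒢
    h39ℋ Dℋ hcofℋ hSℋ hfinℋ hneℋ hconnℋ ρℋ baseActℋ Tℋ Rℋ Rcℋ hVℋ hEℋ hopenℋ hBRℋ wℋ dℋ hkerℋ hfaithVℋ nℋ hCCℋ
    rfl noSwitchℋ hRcVℋ hRcBℋ hestℋ hbotℋ
    dict θd hlo φc hφc hfaith hfull F𝒢 θ𝒢 hrep𝒢 hpre Fℋ θℋ hrepℋ hpost
    (fun φ _ _ => continuous_outerSemidirectProductMap_arithLevelTopology (D𝒢.chart h39𝒢.toProp36Hypotheses.isCountable hcof𝒢 h39𝒢.toProp36Hypotheses.isConnected hS𝒢 hfin𝒢 hne𝒢) (Dℋ.chart h39ℋ.toProp36Hypotheses.isCountable hcofℋ h39ℋ.toProp36Hypotheses.isConnected hSℋ hfinℋ hneℋ) ρ𝒢 baseAct𝒢 ρℋ baseActℋ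
        h39ℋ.thm37Hypotheses h39𝒢.toProp36Hypotheses h39ℋ.toProp36Hypotheses IsTempered.of_profinite IsTempered.of_profinite
        (D𝒢.piPresentation h39𝒢.toProp36Hypotheses.isCountable T𝒢 R𝒢) hP𝒢' w𝒢 hcpt𝒢' (fun n => (D𝒢.projAut h39𝒢.toProp36Hypotheses.isCountable n).ker) (fun _ => MonoidHom.normal_ker _)
        hKL𝒢'.1 (D𝒢.ker_projAut_anti h39𝒢.toProp36Hypotheses.isCountable) (D𝒢.isOpen_ker_projAut h39𝒢.toProp36Hypotheses.isCountable)
        (fun _ hU => D𝒢.exists_ker_projAut_subset h39𝒢.toProp36Hypotheses.isCountable hU) hK1𝒢'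
        (Dℋ.piPresentation h39ℋ.toProp36Hypotheses.isCountable Tℋ Rℋ) hPℋ' wℋ hcptℋ' (fun n => (Dℋ.projAut h39ℋ.toProp36Hypotheses.isCountable n).ker) (fun _ => MonoidHom.normal_ker _)
        hKLℋ'.1 (Dℋ.ker_projAut_anti h39ℋ.toProp36Hypotheses.isCountable) (Dℋ.isOpen_ker_projAut h39ℋ.toProp36Hypotheses.isCountable)
        (fun _ hU => Dℋ.exists_ker_projAut_subset h39ℋ.toProp36Hypotheses.isCountable hU) hK1ℋ'
        e.toMonoidHom he (dict φ.geom) (θd φ.geom) (hlo φ.geom) (φc φ.geom) (hφc φ.geom) _ _ w𝒢 (hPH𝒢 w𝒢) (hPHℋ _))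
    Rc'𝒢 Rc'ℋ he

end Literature.AnabelianGeometry.SemiGraphs
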